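import Literature.AlgebraicGeometry.Frobenioids.ArithmeticFrobenioidNonDilating
import Literature.AlgebraicGeometry.Frobenioids.ArithmeticFrobenioidsProofs
import Literature.AlgebraicGeometry.Frobenioids.ModelFrobenioidStandardProofs
import HarnessLib

/-!
# Frobenioids I, Example 6.3 / Theorem 6.4 (i): the arithmetic model `C_{K/F}` IS a Frobenioid, of standard
# type — PROOF

Mochizuki, *The geometry of Frobenioids I: the general theory*, Kyushu J. Math. **62** (2008) 293–400,
Example 6.3, kurims text p. 113: "Thus we may apply Theorem 5.2, (ii), to conclude the existence of a Frobenioid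
`C_{F̃/F}`"; Theorem 6.4 (i), p. 114: "`C_i` [the associated model Frobenioid of Theorem 5.2, (ii)] … is of
isotropic … and rationally standard type, but not of group-like type"; proof p. 115: "`Φ` is nonzero [so `C` is
not of group-like type] … `D` is … of FSM-type, hence also of FSMFF-type … `Φ` is non-dilating … so `C` is of
standard type". [cite: MochizukiFrdI2008, Thm. 6.4 (i) p.114]

PROOF-ONLY capstone (seat abc-iut-L6-t10) assembling, for THE constructed arithmetic model
`arithFrobenioid F K := ModelFrobenioid (arithDivisorFunctor F K) (unitsFunctor F K) (divNatTrans F K)`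
(`ArithmeticFrobenioidModel.lean`), number fields `F ⊆ K` with `K/F` Galois:
* `arithFrobenioid_isFrobenioid` — **`C_{K/F}` IS A FROBENIOID** (abc-iut-found's Thm. 5.2 (ii)
  `ModelFrobenioid.isFrobenioid` applied to `arith_hypotheses`, `ArithmeticFrobenioidHypotheses.lean`);
* `isOfStandardType_arith` — **`C_{K/F}` is of standard type**, UNCONDITIONAL (abc-iut-L1-t2's Thm. 5.2 (iii)
  `ModelFrobenioid.standardTypeIff_holds` applied to `isOfStandardType_arith_of`,
  `ArithmeticFrobenioidNonDilating.lean`: `Φ ≠ 0`, `D` of FSMFF-type, `Φ` non-dilating);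
* `Thm64i_frobenioid_arith_iff` — abc-iut-L1-t3's named `Thm64i_frobenioid (arithModelFrobenioid F K) R`
  REDUCED to the conjuncts that quote constructions not yet in the tree (birationally Frobenius-normalized
  type of `R.B`, rational type w.r.t. `R.Supp`, a Frobenius-compact object of `(C^un-tr)^birat`): isotropic
  (`isOfIsotropicType_arith`), not group-like (`not_isOfGroupLikeType_arith`) and standard
  (`isOfStandardType_arith`) are PROVED.
No definitions; nothing here bears on [IUTchIII] or asserts anything about abc.
-/

noncomputable section

namespace Literature.AlgebraicGeometry.Frobenioids

open CategoryTheory Opposite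

variable (F : Type) [Field F] [NumberField F] (K : Type) [Field K] [Algebra F K] [IsGalois F K]

/-- **Example 6.3 / Theorem 6.4: the arithmetic model `C_{K/F}` is a Frobenioid** ("we may apply Theorem 5.2,
(ii), to conclude the existence of a Frobenioid", FrdI p. 113) — PROVED: abc-iut-found's Thm. 5.2 (ii)
(`ModelFrobenioid.isFrobenioid`) applied to the standing hypotheses `arith_hypotheses` (`Φ` divisorial monoid on
`D`, `B` group-like monoid on `D`, `D` connected and totally epimorphic). [cite: MochizukiFrdI2008, Ex. 6.3 p.113] -/
theorem arithFrobenioid_isFrobenioid :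
    PreFrobenioid.IsFrobenioid
      (ModelFrobenioid.toElem (arithDivisorFunctor F K) (unitsFunctor F K) (divNatTrans F K)) :=
  have h := arith_hypotheses F K
  ModelFrobenioid.isFrobenioid h.isMonoidOn h.isDivisorial h.isMonoidOn_rat h.isGroupLike_rat
    h.isGraphConnected h.isTotallyEpimorphic

/-- **Theorem 6.4 (i): `C_{K/F}` is of standard type** (FrdI p. 114, proof p. 115) — PROVED unconditionally:
abc-iut-L1-t2's Thm. 5.2 (iii) `ModelFrobenioid.standardTypeIff_holds` with its three clauses discharged in
`ArithmeticFrobenioidNonDilating.lean` (`Φ ≠ 0`, `D` of FSMFF-type, `Φ` non-dilating).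
[cite: MochizukiFrdI2008, Thm. 6.4 (i) p.114] -/
theorem isOfStandardType_arith : (arithFrobenioidOps F K).IsOfStandardType :=
  isOfStandardType_arith_of F K (ModelFrobenioid.standardTypeIff_holds _ _ _)

/-- The packaged model's operations are of standard type. [cite: MochizukiFrdI2008, Thm. 6.4 (i) p.114] -/
theorem arithModelFrobenioid_isOfStandardType : (arithModelFrobenioid F K).ops.IsOfStandardType :=
  isOfStandardType_arith F K

/-- **Theorem 6.4 (i), Frobenioid part, for THE constructed `C_{K/F}`** — abc-iut-L1-t3's named statement
`Thm64i_frobenioid (arithModelFrobenioid F K) R` REDUCED to the conjuncts of "rationally standard type"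
(Def. 4.5 (iii)) that quote constructions given only as the parameters `R : RSParams` (birationalization,
support predicate, `(C^un-tr)^birat`): (a) birationally Frobenius-normalized type, rational type, (b) a
Frobenius-compact object of `(C^un-tr)^birat`. The conjuncts "isotropic type", "not of group-like type" and
"standard type" are PROVED (`isOfIsotropicType_arith`, `not_isOfGroupLikeType_arith`, `isOfStandardType_arith`).
[cite: MochizukiFrdI2008, Thm. 6.4 (i) p.114] -/
theorem Thm64i_frobenioid_arith_iff (R : (arithModelFrobenioid F K).ops.RSParams) :
    Thm64i_frobenioid (arithModelFrobenioid F K) R ↔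
      (PreFrobenioidData.IsOfBiratFrobeniusNormalizedType R.B ∧
        (∀ A : arithFrobenioid F K, PreFrobenioidData.IsRational R.B R.Supp A) ∧
          ∃ X : R.BU.Birat, R.BU.ops.IsFrobeniusCompact X) := by
  constructor
  · rintro ⟨-, hRS, -⟩
    exact ⟨hRS.biratFrobNormalized, hRS.rational, hRS.frobCompact⟩
  · rintro ⟨hB, hR, hC⟩
    exact ⟨isOfIsotropicType_arith F K, ⟨hB, hR, isOfStandardType_arith F K, hC⟩,
      not_isOfGroupLikeType_arith F K⟩

end Literature.AlgebraicGeometry.Frobenioids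

end
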